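import Literature.NumberTheory.ConnesConsani2021.CosineTail
import Literature.Analysis.FunctionSpaces.PlancherelL1L2
import HarnessLib

/-!
# Connes–Consani 2021, Prop. 2.2 (iii) discharge: Plancherel for the cosine tail (RH-FREE)

A. Connes, C. Consani, *Weil positivity and trace formula, the archimedean place*, Selecta Math. (N.S.)
27 (2021) 77 = arXiv:2006.13771 [bib: `ConnesConsani2021`], §1–§2 (Prop. 2.2 (iii) = the named fact
`CC2021_prop_2_2_iii`).  Cell `rh-crit/cc`; seat gm-t15 (lead writer of the discharge); this leaf
supplies the two PLANCHEREL inputs of the frame of the cosine-tail energy identity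
(`CosineTailEnergy.lean`, seat gm-t13; route memo cc/drafts/t1g2-T2-ROUTE.md §2 (P)), over the shared
definitions of `CosineTail.lean` (seat t1):

* `fourierIntegral_cutLogProfile` — with `f_m(x) := 1_{|x| ≥ e^{−m}} g(log|x|)|x|^{-1/2}` (even,
  bounded, compactly supported), `𝓕 f_m (±e^c) = 2 e^{−c/2} · cosTail g (c − m) c`: the cut cosine
  transform of the profile `x^{-1/2}g(log x)` IS the cosine tail (substitution `x = e^u`; §1 Lemma 1.4 (i),
  the cosine kernel, and eq. (17), the cutoff `P`);
* **`integral_norm_sq_cosTail_sub`**: `∫_ℝ |cosTail g (c − m) c|² dc = ¼ ∫_{σ ≥ −m} |g(σ)|² dσ`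
  (Plancherel for `f_m`, `PlancherelL1L2.integral_norm_sq_fourierIntegral_eq`, and `w = e^c`), with the
  integrability statement `integrable_norm_sq_cosTail_sub`;
* **`integral_norm_sq_cosTailFull`**: `∫_ℝ |cosTailFull g c|² dc = ¼ ∫ |g|²` (the cut below the support,
  `cosTail_eq_cosTailFull`).

Theorems only; no definition, no named fact, no instance, no `sorry`.  Net debt delta 0.
bears_on: W-C/W-P (K1 boundary fact `CC2021_prop_2_2_iii`).  WHAT THIS IS NOT: any claim about RH —
Plancherel bookkeeping for an archimedean cosine transform; nothing here bears on the truth of RH.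

## References
* A. Connes, C. Consani, Selecta Math. (N.S.) 27 (2021) 77 = arXiv:2006.13771, §1 Lemma 1.4 (i),
  eq. (16)–(17) p. 7; §2 Prop. 2.2 (iii) proof p. 10 (chunk p0010:L28–L40). [ConnesConsani2021]
-/

noncomputable section

open MeasureTheory Complex Set Filter Function
open scoped Real ComplexConjugate ENNReal Topology FourierTransform

namespace Literature.NumberTheory.ConnesConsani2021

open Literature.NumberTheory.LFunctions

variable {g : ℝ → ℂ}

/-! ## The cut logarithmic profile `f_m(x) = 1_{|x| ≥ e^{-m}} g(log|x|) |x|^{-1/2}` -/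

/-- Outside `[−R, R]` one has `R < |x|`. [folklore] -/
private theorem lt_abs_of_not_mem_Icc' {R x : ℝ} (h : x ∉ Icc (-R) R) : R < |x| := by
  simp only [mem_Icc, not_and_or, not_le] at h
  rcases h with h | h
  · calc R < -x := by linarith
      _ ≤ |x| := neg_le_abs x
  · exact h.trans_le (le_abs_self x)

/-- A bounded, a.e.-strongly measurable function vanishing off a bounded interval is integrable. [folklore] -/
private theorem integrable_of_norm_le_of_eq_zero'' {E : Type*} [NormedAddCommGroup E] {f : ℝ → E}
    (hf : AEStronglyMeasurable f volume) {M R : ℝ} (hM : ∀ x, ‖f x‖ ≤ M)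
    (hR : ∀ x, R < |x| → f x = 0) : Integrable f volume := by
  have hs : IntegrableOn f (Icc (-R) R) volume :=
    Measure.integrableOn_of_bounded (by rw [Real.volume_Icc]; exact ENNReal.ofReal_ne_top) hf
      (ae_of_all _ fun x => hM x)
  exact hs.integrable_of_forall_notMem_eq_zero fun x hx => hR x (lt_abs_of_not_mem_Icc' hx)

/-- … and square integrable. [folklore] -/
private theorem memLp_two_of_norm_le_of_eq_zero'' {f : ℝ → ℂ} (hf : AEStronglyMeasurable f volume)
    {M R : ℝ} (hM : ∀ x, ‖f x‖ ≤ M) (hR : ∀ x, R < |x| → f x = 0) : MemLp f 2 volume := by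
  rw [memLp_two_iff_integrable_sq_norm hf]
  refine integrable_of_norm_le_of_eq_zero'' ((continuous_pow 2).comp_aestronglyMeasurable hf.norm)
    (M := M ^ 2) (R := R) (fun x => ?_) (fun x hx => by simp [hR x hx])
  rw [Real.norm_eq_abs, abs_pow, abs_norm]
  exact pow_le_pow_left₀ (norm_nonneg _) (hM x) 2

/-- Folding a line integral onto the half-line: `∫_ℝ F = ∫_{(0,∞)} (F(x) + F(−x)) dx`. [folklore] -/
private theorem integral_eq_integral_Ioi_add_neg' {F : ℝ → ℂ} (hF : Integrable F (volume : Measure ℝ)) :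
    ∫ x, F x = ∫ x in Ioi 0, (F x + F (-x)) := by
  rw [← integral_add_compl (measurableSet_Ioi (a := (0 : ℝ))) hF, compl_Ioi,
    integral_add hF.integrableOn hF.comp_neg.integrableOn]
  congr 1
  have h := integral_comp_neg_Ioi 0 F
  rw [neg_zero] at h
  exact h.symm

/-- The same folding for real-valued integrands. [folklore] -/
private theorem integral_eq_integral_Ioi_add_neg_real {F : ℝ → ℝ} (hF : Integrable F (volume : Measure ℝ)) :
    ∫ x, F x = ∫ x in Ioi 0, (F x + F (-x)) := by
  rw [← integral_add_compl (measurableSet_Ioi (a := (0 : ℝ))) hF, compl_Ioi,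
    integral_add hF.integrableOn hF.comp_neg.integrableOn]
  congr 1
  have h := integral_comp_neg_Ioi 0 F
  rw [neg_zero] at h
  exact h.symm

/-- `e^{−ia} + e^{ia} = 2 cos a`. [folklore] -/
private theorem cexp_neg_add_cexp' (a : ℝ) :
    cexp (↑(-a) * I) + cexp (↑a * I) = ((2 * Real.cos a : ℝ) : ℂ) := by
  rw [Complex.ofReal_mul, Complex.ofReal_ofNat, Complex.ofReal_cos, Complex.two_cos, add_comm,
    Complex.ofReal_neg, neg_mul]

/-- The cut logarithmic profile (local notation of this file, as a plain function). [folklore] -/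
private def cutLogProfile (g : ℝ → ℂ) (m x : ℝ) : ℂ :=
  if Real.exp (-m) ≤ |x| then g (Real.log |x|) * (((Real.sqrt |x|)⁻¹ : ℝ) : ℂ) else 0

/-- `f_m` is even. [folklore] -/
private theorem cutLogProfile_neg (m x : ℝ) : cutLogProfile g m (-x) = cutLogProfile g m x := by
  simp [cutLogProfile, abs_neg]

/-- `f_m(e^u) = 1_{u ≥ −m} g(u) e^{−u/2}`. [folklore] -/
private theorem cutLogProfile_exp (m u : ℝ) :
    cutLogProfile g m (Real.exp u) = if -m ≤ u then g u * ((Real.exp (-(u / 2)) : ℝ) : ℂ) else 0 := by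
  unfold cutLogProfile
  rw [abs_of_pos (Real.exp_pos u), Real.log_exp]
  by_cases h : -m ≤ u
  · rw [if_pos (Real.exp_le_exp.mpr h), if_pos h, ← Real.exp_half, ← Real.exp_neg]
  · rw [if_neg (fun h' => h (Real.exp_le_exp.mp h')), if_neg h]

/-- `f_m` is measurable. [folklore] -/
private theorem measurable_cutLogProfile (hg : Measurable g) (m : ℝ) : Measurable (cutLogProfile g m) := by
  unfold cutLogProfile
  refine Measurable.ite (measurableSet_le measurable_const continuous_abs.measurable) ?_ measurable_const
  exact (hg.comp continuous_abs.measurable.log).mul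
    (measurable_ofReal.comp (continuous_abs.measurable.sqrt.inv))

/-- `f_m` is bounded by `‖g‖_∞ e^{m/2}` and vanishes for `|x| > e^T` when `g` vanishes off `(−T, T)`. [folklore] -/
private theorem norm_cutLogProfile_le {M : ℝ} (hM : ∀ t, ‖g t‖ ≤ M) (m x : ℝ) :
    ‖cutLogProfile g m x‖ ≤ M * Real.exp (m / 2) := by
  have hM0 : 0 ≤ M := (norm_nonneg _).trans (hM 0)
  unfold cutLogProfile
  by_cases h : Real.exp (-m) ≤ |x|
  · rw [if_pos h, norm_mul, Complex.norm_real, Real.norm_eq_abs,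
      abs_of_nonneg (inv_nonneg.mpr (Real.sqrt_nonneg _))]
    refine mul_le_mul (hM _) ?_ (inv_nonneg.mpr (Real.sqrt_nonneg _)) hM0
    have hx : 0 < |x| := (Real.exp_pos _).trans_le h
    have h1 : Real.exp (-(m / 2)) ≤ Real.sqrt |x| := by
      rw [show (-(m / 2) : ℝ) = -m / 2 by ring, Real.exp_half]
      exact Real.sqrt_le_sqrt h
    exact (inv_anti₀ (Real.exp_pos _) h1).trans_eq (by rw [Real.exp_neg, inv_inv])
  · rw [if_neg h, norm_zero]
    positivity

/-- `f_m` vanishes for `|x| > e^T` when `g` vanishes off `(−T, T)`. [folklore] -/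
private theorem cutLogProfile_eq_zero_of_lt {T : ℝ} (hT : ∀ t, T ≤ |t| → g t = 0) {m x : ℝ}
    (hx : Real.exp T < |x|) : cutLogProfile g m x = 0 := by
  unfold cutLogProfile
  by_cases h : Real.exp (-m) ≤ |x|
  · rw [if_pos h]
    have hx0 : 0 < |x| := (Real.exp_pos _).trans hx
    have hlog : T < Real.log |x| := by rw [Real.lt_log_iff_exp_lt hx0]; exact hx
    rw [hT _ (hlog.le.trans (le_abs_self _)), zero_mul]
  · rw [if_neg h]

/-- `f_m ∈ L¹ ∩ L²`. [folklore] -/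
private theorem integrable_memLp_cutLogProfile (hg : Continuous g) (hgs : HasCompactSupport g) (m : ℝ) :
    Integrable (cutLogProfile g m) ∧ MemLp (cutLogProfile g m) 2 (volume : Measure ℝ) := by
  obtain ⟨M, hM⟩ := hg.bounded_above_of_compact_support hgs
  obtain ⟨T, -, hT⟩ := hgs.exists_pos_le_norm
  have hT' : ∀ t, T ≤ |t| → g t = 0 := fun t ht => hT t (by simpa using ht)
  have hmeas : AEStronglyMeasurable (cutLogProfile g m) (volume : Measure ℝ) :=
    (measurable_cutLogProfile hg.measurable m).aestronglyMeasurable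
  exact ⟨integrable_of_norm_le_of_eq_zero'' hmeas (norm_cutLogProfile_le hM m)
      (fun x hx => cutLogProfile_eq_zero_of_lt hT' hx),
    memLp_two_of_norm_le_of_eq_zero'' hmeas (norm_cutLogProfile_le hM m)
      (fun x hx => cutLogProfile_eq_zero_of_lt hT' hx)⟩

/-! ## The Fourier transform of the cut profile is the cosine tail -/

/-- **The cut cosine transform of the profile is the cosine tail**: for `w = ±e^c`,
`𝓕 f_m (w) = 2 e^{−c/2} · cosTail g (c − m) c`, where `f_m(x) = 1_{|x| ≥ e^{−m}} g(log|x|)|x|^{-1/2}`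
(fold the line integral onto `(0, ∞)`, `e^{−2πixw} + e^{2πixw} = 2cos`, substitute `x = e^u`).
[cite: ConnesConsani2021, §1 Lemma 1.4 (i) eq. (16)–(17) p. 7; §2 Prop. 2.2 (iii) proof p. 10] -/
private theorem fourierIntegral_cutLogProfile (hg : Continuous g) (hgs : HasCompactSupport g) (m c : ℝ)
    {w : ℝ} (hw : |w| = Real.exp c) :
    𝓕 (cutLogProfile g m) w = ((2 * Real.exp (-(c / 2)) : ℝ) : ℂ) * cosTail g (c - m) c := by
  have hFi : Integrable (fun x => cexp (↑(-2 * π * x * w) * I) * cutLogProfile g m x) := by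
    refine (integrable_memLp_cutLogProfile hg hgs m).1.bdd_mul (c := 1) ?_ (ae_of_all _ fun x => ?_)
    · exact (Complex.continuous_exp.comp ((continuous_ofReal.comp (by fun_prop)).mul
        continuous_const)).aestronglyMeasurable
    · rw [Complex.norm_exp_ofReal_mul_I]
  rw [Real.fourier_real_eq_integral_exp_smul]
  simp only [smul_eq_mul]
  rw [integral_eq_integral_Ioi_add_neg' hFi]
  have hsum : ∀ x, cexp (↑(-2 * π * x * w) * I) * cutLogProfile g m x
      + cexp (↑(-2 * π * (-x) * w) * I) * cutLogProfile g m (-x)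
      = ((2 * Real.cos (2 * π * x * w) : ℝ) : ℂ) * cutLogProfile g m x := by
    intro x
    rw [cutLogProfile_neg, ← add_mul, show (-2 * π * x * w : ℝ) = -(2 * π * x * w) by ring,
      show (-2 * π * (-x) * w : ℝ) = 2 * π * x * w by ring, cexp_neg_add_cexp']
  simp_rw [hsum]
  -- substitute `x = e^u`
  have hcv := integral_image_eq_integral_abs_deriv_smul MeasurableSet.univ
    (fun u _ => (Real.hasDerivAt_exp u).hasDerivWithinAt) Real.exp_injective.injOn
    (fun x => ((2 * Real.cos (2 * π * x * w) : ℝ) : ℂ) * cutLogProfile g m x)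
  rw [image_univ, Real.range_exp, Measure.restrict_univ] at hcv
  rw [hcv, cosTail_eq_integral_comp_add, show c - m - c = -m by ring, ← integral_indicator measurableSet_Ici,
    ← integral_const_mul]
  refine integral_congr_ae (ae_of_all _ fun u => ?_)
  simp only
  rw [abs_of_pos (Real.exp_pos u), cutLogProfile_exp]
  by_cases hu : -m ≤ u
  · rw [if_pos hu, indicator_of_mem (mem_Ici.mpr hu)]
    -- `cos(2π e^u w) = cos(2π e^{u+c})`
    have hcos : Real.cos (2 * π * Real.exp u * w) = Real.cos (2 * π * Real.exp (u + c)) := by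
      rcases le_or_gt 0 w with h0 | h0
      · rw [abs_of_nonneg h0] at hw
        rw [hw, Real.exp_add, mul_assoc]
      · rw [abs_of_neg h0] at hw
        rw [show w = -Real.exp c by linarith, Real.exp_add, show 2 * π * Real.exp u * -Real.exp c
          = -(2 * π * (Real.exp u * Real.exp c)) by ring, Real.cos_neg]
    rw [hcos, cosTailKernel, Complex.real_smul]
    have hexp : Real.exp u * Real.exp (-(u / 2)) = Real.exp (-(c / 2)) * Real.exp ((u + c) / 2) := by
      rw [← Real.exp_add, ← Real.exp_add]; ring_nf
    have hexpC := congrArg (fun r : ℝ => (r : ℂ)) hexp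
    simp only [Complex.ofReal_mul, Complex.ofReal_ofNat] at hexpC ⊢
    linear_combination ((2 : ℂ) * (Real.cos (2 * π * Real.exp (u + c)) : ℂ) * g u) * hexpC
  · rw [if_neg hu, indicator_of_notMem (fun h => hu (mem_Ici.mp h)), mul_zero, smul_zero, mul_zero]

/-! ## Plancherel -/

/-- **Plancherel for the cut cosine tail**: `∫_ℝ |cosTail g (c − m) c|² dc = ¼ ∫_{σ ≥ −m} |g(σ)|² dσ`,
together with the integrability of `c ↦ |cosTail g (c − m) c|²` (the frame's input (P):
`𝓕 f_m(±e^c) = 2e^{−c/2}cosTail g (c−m) c`, `∫|𝓕 f_m|² = ∫|f_m|²`, `w = e^c`, `x = e^σ`).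
[cite: ConnesConsani2021, §1 Lemma 1.4 (i) eq. (16)–(17) p. 7; §2 Prop. 2.2 (iii) proof p. 10 (chunk p0010:L28–L40)] -/
theorem integrable_norm_sq_cosTail_sub (hg : Continuous g) (hgs : HasCompactSupport g) (m : ℝ) :
    Integrable (fun c => ‖cosTail g (c - m) c‖ ^ 2) (volume : Measure ℝ) ∧
      ∫ c, ‖cosTail g (c - m) c‖ ^ 2 = (1 / 4) * ∫ σ in Ici (-m), ‖g σ‖ ^ 2 := by
  obtain ⟨h1, h2⟩ := integrable_memLp_cutLogProfile hg hgs m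
  set f := cutLogProfile g m with hf
  -- `|𝓕 f|²` is integrable, even, and `∫ |𝓕 f|² = ∫ |f|²`
  have hF2 : Integrable (fun w => ‖𝓕 f w‖ ^ 2) (volume : Measure ℝ) :=
    (memLp_two_iff_integrable_sq_norm
      (Literature.Analysis.FunctionSpaces.memLp_two_fourierIntegral h1 h2).1).1
      (Literature.Analysis.FunctionSpaces.memLp_two_fourierIntegral h1 h2)
  have hPl := Literature.Analysis.FunctionSpaces.integral_norm_sq_fourierIntegral_eq h1 h2
  -- the values of `𝓕 f` on `(0,∞)` and `(-∞,0)` in terms of the cosine tail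
  have hval : ∀ c : ℝ, ‖𝓕 f (Real.exp c)‖ ^ 2 = 4 * Real.exp (-c) * ‖cosTail g (c - m) c‖ ^ 2 := by
    intro c
    rw [fourierIntegral_cutLogProfile hg hgs m c (by rw [abs_of_pos (Real.exp_pos c)]), norm_mul,
      Complex.norm_real, Real.norm_eq_abs, abs_of_pos (by positivity), mul_pow, mul_pow, ← Real.exp_nat_mul]
    ring_nf
  have hval' : ∀ c : ℝ, ‖𝓕 f (-Real.exp c)‖ ^ 2 = ‖𝓕 f (Real.exp c)‖ ^ 2 := by
    intro c
    rw [fourierIntegral_cutLogProfile hg hgs m c (by rw [abs_neg, abs_of_pos (Real.exp_pos c)]),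
      fourierIntegral_cutLogProfile hg hgs m c (by rw [abs_of_pos (Real.exp_pos c)])]
  -- substitution `w = e^c` on `(0, ∞)`: integrability and value
  have hderiv : ∀ c ∈ (univ : Set ℝ), HasDerivWithinAt Real.exp (Real.exp c) univ c :=
    fun c _ => (Real.hasDerivAt_exp c).hasDerivWithinAt
  have hIoi : IntegrableOn (fun w => ‖𝓕 f w‖ ^ 2) (Ioi 0) := hF2.integrableOn
  have hint_c : Integrable (fun c => Real.exp c * ‖𝓕 f (Real.exp c)‖ ^ 2) (volume : Measure ℝ) := by
    have h := (integrableOn_image_iff_integrableOn_abs_deriv_smul MeasurableSet.univ hderiv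
      Real.exp_injective.injOn (fun w => ‖𝓕 f w‖ ^ 2)).1 (by rwa [image_univ, Real.range_exp])
    rw [integrableOn_univ] at h
    refine h.congr (ae_of_all _ fun c => ?_)
    simp only [abs_of_pos (Real.exp_pos c), smul_eq_mul]
  have hcv := integral_image_eq_integral_abs_deriv_smul MeasurableSet.univ hderiv
    Real.exp_injective.injOn (fun w => ‖𝓕 f w‖ ^ 2)
  rw [image_univ, Real.range_exp, Measure.restrict_univ] at hcv
  -- `c ↦ e^c |𝓕 f(e^c)|² = 4 |cosTail g (c-m) c|²`
  have hkey : ∀ c : ℝ, Real.exp c * ‖𝓕 f (Real.exp c)‖ ^ 2 = 4 * ‖cosTail g (c - m) c‖ ^ 2 := by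
    intro c
    rw [hval c, ← mul_assoc, ← mul_assoc, mul_comm (Real.exp c) 4, mul_assoc 4, ← Real.exp_add,
      add_neg_cancel, Real.exp_zero, mul_one]
  have hint : Integrable (fun c => ‖cosTail g (c - m) c‖ ^ 2) (volume : Measure ℝ) := by
    have := hint_c.div_const 4
    refine this.congr (ae_of_all _ fun c => ?_)
    simp only [hkey c]
    ring
  refine ⟨hint, ?_⟩
  -- the value: `∫ |𝓕 f|² = 2 ∫_{(0,∞)} |𝓕 f|² = 2 ∫_c e^c |𝓕 f(e^c)|² = 8 ∫ |cosTail|²`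
  have hL : ∫ w, ‖𝓕 f w‖ ^ 2 = 8 * ∫ c, ‖cosTail g (c - m) c‖ ^ 2 := by
    rw [integral_eq_integral_Ioi_add_neg_real hF2]
    have h2 : ∀ w ∈ Ioi (0 : ℝ), ‖𝓕 f w‖ ^ 2 + ‖𝓕 f (-w)‖ ^ 2 = 2 * ‖𝓕 f w‖ ^ 2 := by
      intro w hw
      obtain ⟨c, rfl⟩ : ∃ c, Real.exp c = w := ⟨Real.log w, Real.exp_log hw⟩
      rw [hval' c]
      ring
    rw [setIntegral_congr_fun measurableSet_Ioi h2, integral_const_mul, hcv]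
    simp_rw [abs_of_pos (Real.exp_pos _), smul_eq_mul, hkey, integral_const_mul]
    ring
  -- the value: `∫ |f|² = 2 ∫_{σ ≥ -m} |g σ|²`
  have hR : ∫ x, ‖f x‖ ^ 2 = 2 * ∫ σ in Ici (-m), ‖g σ‖ ^ 2 := by
    have hf2 : Integrable (fun x => ‖f x‖ ^ 2) (volume : Measure ℝ) :=
      (memLp_two_iff_integrable_sq_norm h2.1).1 h2
    rw [integral_eq_integral_Ioi_add_neg_real hf2]
    have h2' : ∀ x ∈ Ioi (0 : ℝ), ‖f x‖ ^ 2 + ‖f (-x)‖ ^ 2 = 2 * ‖f x‖ ^ 2 := by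
      intro x _
      rw [hf, cutLogProfile_neg]
      ring
    rw [setIntegral_congr_fun measurableSet_Ioi h2', integral_const_mul]
    congr 1
    have hcv' := integral_image_eq_integral_abs_deriv_smul MeasurableSet.univ hderiv
      Real.exp_injective.injOn (fun x => ‖f x‖ ^ 2)
    rw [image_univ, Real.range_exp, Measure.restrict_univ] at hcv'
    rw [hcv', ← integral_indicator measurableSet_Ici]
    refine integral_congr_ae (ae_of_all _ fun u => ?_)
    simp only
    rw [abs_of_pos (Real.exp_pos u), hf, cutLogProfile_exp]
    by_cases hu : -m ≤ u
    · rw [if_pos hu, indicator_of_mem (mem_Ici.mpr hu), smul_eq_mul, norm_mul, Complex.norm_real,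
        Real.norm_eq_abs, abs_of_pos (Real.exp_pos _), mul_pow, ← Real.exp_nat_mul]
      rw [show ((2 : ℕ) : ℝ) * -(u / 2) = -u by push_cast; ring, ← mul_assoc, mul_comm (Real.exp u),
        mul_assoc, ← Real.exp_add, add_neg_cancel, Real.exp_zero, mul_one]
    · rw [if_neg hu, indicator_of_notMem (fun h => hu (mem_Ici.mp h)), norm_zero,
        zero_pow two_ne_zero, smul_zero]
  -- conclude
  have := hPl
  rw [hL, hR] at this
  linarith

/-- **Plancherel for the cut cosine tail** (the value alone). [cite: ConnesConsani2021, §1 Lemma 1.4 (i) eq. (16)–(17) p. 7; §2 Prop. 2.2 (iii) proof p. 10] -/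
theorem integral_norm_sq_cosTail_sub (hg : Continuous g) (hgs : HasCompactSupport g) (m : ℝ) :
    ∫ c, ‖cosTail g (c - m) c‖ ^ 2 = (1 / 4) * ∫ σ in Ici (-m), ‖g σ‖ ^ 2 :=
  (integrable_norm_sq_cosTail_sub hg hgs m).2

/-- **Plancherel for the full cosine transform**: `∫_ℝ |cosTailFull g c|² dc = ¼ ∫ |g|²` when
`supp g ⊆ [−a, a]` (the cut at `m = a` lies below the support: `cosTail g (c − a) c = cosTailFull g c`),
with integrability. [cite: ConnesConsani2021, §1 Lemma 1.3–1.4 p. 7; §2 Prop. 2.2 (iii) proof p. 10] -/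
theorem integrable_norm_sq_cosTailFull (hg : Continuous g) (hgs : HasCompactSupport g) {a : ℝ}
    (hga : tsupport g ⊆ Icc (-a) a) :
    Integrable (fun c => ‖cosTailFull g c‖ ^ 2) (volume : Measure ℝ) ∧
      ∫ c, ‖cosTailFull g c‖ ^ 2 = (1 / 4) * ∫ σ, ‖g σ‖ ^ 2 := by
  obtain ⟨h1, h2⟩ := integrable_norm_sq_cosTail_sub hg hgs a
  have heq : ∀ c : ℝ, cosTail g (c - a) c = cosTailFull g c := fun c =>
    cosTail_eq_cosTailFull hga (by linarith)
  simp_rw [heq] at h1 h2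
  refine ⟨h1, ?_⟩
  rw [h2]
  congr 1
  -- `∫_{σ ≥ -a} |g|² = ∫ |g|²` since `g` vanishes off `[-a, a]`
  rw [← integral_indicator measurableSet_Ici]
  refine integral_congr_ae (ae_of_all _ fun σ => ?_)
  simp only
  by_cases hσ : -a ≤ σ
  · rw [indicator_of_mem (mem_Ici.mpr hσ)]
  · rw [indicator_of_notMem (fun h => hσ (mem_Ici.mp h)),
      image_eq_zero_of_notMem_tsupport (fun h => hσ (hga h).1), norm_zero, zero_pow two_ne_zero]

/-- **Plancherel for the full cosine transform** (the value alone). [cite: ConnesConsani2021, §1 Lemma 1.3–1.4 p. 7; §2 Prop. 2.2 (iii) proof p. 10] -/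
theorem integral_norm_sq_cosTailFull (hg : Continuous g) (hgs : HasCompactSupport g) {a : ℝ}
    (hga : tsupport g ⊆ Icc (-a) a) :
    ∫ c, ‖cosTailFull g c‖ ^ 2 = (1 / 4) * ∫ σ, ‖g σ‖ ^ 2 :=
  (integrable_norm_sq_cosTailFull hg hgs hga).2

end Literature.NumberTheory.ConnesConsani2021

end
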